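import Summits.CriticalPhenomena.CardyFormulaZ2.Theorems.CardyBoundaryCoulombGasStripClusterRatesRectBoxMesh

/-!
# `RectilinearCardy → stub_rectCardyOne`, part 2a: the discrete arc of the left side of `(0,A)×(0,1)`

Support file for line `two-cluster-rate-is-stationary-gap` (crux `StripClusterRates`,
stmt-CriticalPhenomena-13878); continues `…StripClusterRatesRectBoxMesh` (part 1). At mesh `δ = 1/k`
(`k ≥ 2`, integer aspect `A ≥ 1`) the mesh vertices of the box `(0,A)×(0,1)` form the lattice box
`{1,…,Ak−1} × {1,…,k−1}` (`mem_meshVertices_brBox`), and the discrete arc (Smirnov 2001 §2: boundary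
vertices of `Ω_δ` at least as close to the arc as to the rest of `∂Ω`) of the LEFT side `{0} × [0,1]` is
EXACTLY its first column (`discreteArc_left`; registered sub-goal `rc_discreteArc_left`). Tools: the feet
of a mesh point on the four sides and the resulting exact / lower bounds for `infDist`.
No definitions are introduced.
-/

noncomputable section

namespace Summit.CriticalPhenomena.CardyFormulaZ2.Cruxes.StripClusterRates.TwoClusterRateIsStationaryGap

open Set Metric Complex
open Literature.Probability.LatticeModels Literature.Probability.Percolation

namespace RectBox

/-! ## The lattice box of `brRect A 1` at mesh `1/k` -/

variable {A k : ℕ}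

/-- The mesh `1/k` is positive. -/
theorem mesh_pos (hk : 1 ≤ k) : (0 : ℝ) < 1 / k := by
  have : (0 : ℝ) < k := by exact_mod_cast hk
  positivity

/-- Mesh vertices of `(0,A)×(0,1)` at mesh `1/k`: the lattice box `{1,…,Ak−1} × {1,…,k−1}`. [folklore] -/
theorem mem_meshVertices_brBox (hk : 1 ≤ k) {v : Site 2} :
    v ∈ meshVertices (Ioo (0 : ℝ) A ×ℂ Ioo (0 : ℝ) 1) (1 / (k : ℝ)) ↔
      (1 ≤ v 0 ∧ v 0 + 1 ≤ (A : ℤ) * k) ∧ (1 ≤ v 1 ∧ v 1 + 1 ≤ (k : ℤ)) := by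
  have hk0 : (0 : ℝ) < k := by exact_mod_cast hk
  rw [mem_meshVertices_obox_div (mesh_pos hk)]
  have e1 : (A : ℝ) / (1 / k) = ((A * k : ℤ) : ℝ) := by push_cast; field_simp
  have e2 : (1 : ℝ) / (1 / k) = ((k : ℤ) : ℝ) := by push_cast; field_simp
  rw [e1, e2, Int.cast_lt, Int.cast_lt]
  omega

/-- The meshpoint of `v` at mesh `1/k`, in coordinates. -/
theorem meshPoint_coords (v : Site 2) :
    (meshPoint (1 / (k : ℝ)) v).re = (v 0 : ℝ) / k ∧ (meshPoint (1 / (k : ℝ)) v).im = (v 1 : ℝ) / k := by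
  rw [meshPoint_re, meshPoint_im]; constructor <;> ring

/-! ## The discrete arcs of the two sides -/

/-- Lower bounds on distances through coordinates. -/
theorem re_im_sub_le_dist (p q : ℂ) :
    p.re - q.re ≤ dist p q ∧ q.re - p.re ≤ dist p q ∧ p.im - q.im ≤ dist p q ∧ q.im - p.im ≤ dist p q := by
  have hre : |(p - q).re| ≤ dist p q := by rw [dist_eq_norm]; exact abs_re_le_norm _
  have him : |(p - q).im| ≤ dist p q := by rw [dist_eq_norm]; exact abs_im_le_norm _
  rw [sub_re, abs_le] at hre
  rw [sub_im, abs_le] at him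
  exact ⟨hre.2, by linarith [hre.1], him.2, by linarith [him.1]⟩

/-! ### Feet of a point on the sides -/

/-- Distance to the foot on the bottom line. -/
theorem dist_foot_bottom (p : ℂ) (hy : 0 ≤ p.im) : dist p ((p.re : ℝ) : ℂ) = p.im := by
  rw [dist_eq_norm]
  have e : p - ((p.re : ℝ) : ℂ) = (p.im : ℂ) * I := by apply Complex.ext <;> simp
  rw [e, norm_mul, Complex.norm_real, Complex.norm_I, mul_one, Real.norm_eq_abs, abs_of_nonneg hy]

/-- Distance to the foot on the top line `im = 1`. -/
theorem dist_foot_top (p : ℂ) (hy : p.im ≤ 1) : dist p (((p.re : ℝ) : ℂ) + I) = 1 - p.im := by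
  rw [dist_eq_norm]
  have e : p - (((p.re : ℝ) : ℂ) + I) = ((p.im - 1 : ℝ) : ℂ) * I := by apply Complex.ext <;> simp
  rw [e, norm_mul, Complex.norm_real, Complex.norm_I, mul_one, Real.norm_eq_abs,
    abs_of_nonpos (by linarith)]
  ring

/-- Distance to the foot on the right line `re = A`. -/
theorem dist_foot_right (p : ℂ) {a : ℝ} (hx : p.re ≤ a) :
    dist p ((a : ℂ) + (p.im : ℂ) * I) = a - p.re := by
  rw [dist_eq_norm]
  have e : p - ((a : ℂ) + (p.im : ℂ) * I) = ((p.re - a : ℝ) : ℂ) := by apply Complex.ext <;> simp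
  rw [e, Complex.norm_real, Real.norm_eq_abs, abs_of_nonpos (by linarith)]
  ring

/-- Distance to the foot on the left line `re = 0`. -/
theorem dist_foot_left (p : ℂ) (hx : 0 ≤ p.re) : dist p ((p.im : ℂ) * I) = p.re := by
  rw [dist_eq_norm]
  have e : p - (p.im : ℂ) * I = ((p.re : ℝ) : ℂ) := by apply Complex.ext <;> simp
  rw [e, Complex.norm_real, Real.norm_eq_abs, abs_of_nonneg hx]

/-- The bottom foot of an interior point is a frontier point off both vertical sides. -/
theorem foot_bottom_mem (hA : (0 : ℝ) < A) {p : ℂ} (hx : p.re ∈ Ioo (0 : ℝ) A) :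
    ((p.re : ℝ) : ℂ) ∈ frontier (Ioo (0 : ℝ) A ×ℂ Ioo (0 : ℝ) 1) ∧
      ((p.re : ℝ) : ℂ) ∉ {z : ℂ | z.re = 0 ∧ z.im ∈ Icc (0 : ℝ) 1} ∧
      ((p.re : ℝ) : ℂ) ∉ {z : ℂ | z.re = A ∧ z.im ∈ Icc (0 : ℝ) 1} := by
  refine ⟨(mem_frontier_obox hA one_pos).2 (Or.inl ⟨by simpa using ⟨hx.1.le, hx.2.le⟩, Or.inl (by simp)⟩),
    fun hm ↦ ?_, fun hm ↦ ?_⟩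
  · have := hm.1; simp at this; exact hx.1.ne' this
  · have := hm.1; simp at this; exact hx.2.ne this

/-- The top foot of an interior point is a frontier point off both vertical sides. -/
theorem foot_top_mem (hA : (0 : ℝ) < A) {p : ℂ} (hx : p.re ∈ Ioo (0 : ℝ) A) :
    (((p.re : ℝ) : ℂ) + I) ∈ frontier (Ioo (0 : ℝ) A ×ℂ Ioo (0 : ℝ) 1) ∧
      (((p.re : ℝ) : ℂ) + I) ∉ {z : ℂ | z.re = 0 ∧ z.im ∈ Icc (0 : ℝ) 1} ∧
      (((p.re : ℝ) : ℂ) + I) ∉ {z : ℂ | z.re = A ∧ z.im ∈ Icc (0 : ℝ) 1} := by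
  refine ⟨(mem_frontier_obox hA one_pos).2 (Or.inl ⟨by simpa using ⟨hx.1.le, hx.2.le⟩, Or.inr (by simp)⟩),
    fun hm ↦ ?_, fun hm ↦ ?_⟩
  · have := hm.1; simp at this; exact hx.1.ne' this
  · have := hm.1; simp at this; exact hx.2.ne this

/-- The right foot is a frontier point off the left side. -/
theorem foot_right_mem (hA : (0 : ℝ) < A) {p : ℂ} (hy : p.im ∈ Icc (0 : ℝ) 1) :
    ((A : ℂ) + (p.im : ℂ) * I) ∈
      frontier (Ioo (0 : ℝ) A ×ℂ Ioo (0 : ℝ) 1) \ {z : ℂ | z.re = 0 ∧ z.im ∈ Icc (0 : ℝ) 1} := by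
  refine ⟨(mem_frontier_obox hA one_pos).2 (Or.inr ⟨Or.inr (by simp), by simpa using hy⟩), fun hm ↦ ?_⟩
  have := hm.1; simp at this; exact hA.ne' (by exact_mod_cast this)

/-- The left foot is a frontier point off the right side. -/
theorem foot_left_mem (hA : (0 : ℝ) < A) {p : ℂ} (hy : p.im ∈ Icc (0 : ℝ) 1) :
    ((p.im : ℂ) * I) ∈
      frontier (Ioo (0 : ℝ) A ×ℂ Ioo (0 : ℝ) 1) \ {z : ℂ | z.re = A ∧ z.im ∈ Icc (0 : ℝ) 1} := by
  refine ⟨(mem_frontier_obox hA one_pos).2 (Or.inr ⟨Or.inl (by simp), by simpa using hy⟩), fun hm ↦ ?_⟩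
  have := hm.1; simp at this; exact hA.ne' (by exact_mod_cast this.symm)


/-- The crossing arcs and their complements in the frontier of `(0,A)×(0,1)`: distance bounds from a
mesh point `p = (x, y)` with `0 < y < 1`, `0 < x < A`. For the LEFT side: `infDist p L = x`, and
every frontier point off `L` is at distance `≥ min y (min (1 - y) (A - x))`. [folklore] -/
theorem infDist_left_eq (hA : (0 : ℝ) < A) {p : ℂ} (hx : 0 ≤ p.re) (hy : p.im ∈ Icc (0 : ℝ) 1) :
    infDist p {z : ℂ | z.re = 0 ∧ z.im ∈ Icc (0 : ℝ) 1} = p.re := by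
  have _ := hA
  refine le_antisymm ?_ ?_
  · have hmem : (p.im : ℂ) * I ∈ {z : ℂ | z.re = 0 ∧ z.im ∈ Icc (0 : ℝ) 1} := ⟨by simp, by simpa using hy⟩
    exact (infDist_le_dist_of_mem hmem).trans_eq (dist_foot_left p hx)
  · have h0 : (0 : ℂ) ∈ {z : ℂ | z.re = 0 ∧ z.im ∈ Icc (0 : ℝ) 1} := ⟨by simp, by simp⟩
    refine (le_infDist ⟨(0 : ℂ), h0⟩).2 fun q hq ↦ ?_
    have := (re_im_sub_le_dist p q).1
    rw [hq.1] at this; linarith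

/-- Distance from an interior-column mesh point to the frontier minus the left side. [folklore] -/
theorem le_dist_of_mem_frontier_diff_left (hA : (0 : ℝ) < A) {p q : ℂ}
    (hq : q ∈ frontier (Ioo (0 : ℝ) A ×ℂ Ioo (0 : ℝ) 1) \ {z : ℂ | z.re = 0 ∧ z.im ∈ Icc (0 : ℝ) 1}) :
    min p.im (min (1 - p.im) (A - p.re)) ≤ dist p q := by
  obtain ⟨hqf, hqL⟩ := hq
  obtain ⟨h1, h2, h3, h4⟩ := re_im_sub_le_dist p q
  rcases (mem_frontier_obox hA one_pos).1 hqf with ⟨-, him | him⟩ | ⟨hre | hre, him⟩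
  · rw [him] at h3; exact (min_le_left _ _).trans (by linarith)
  · rw [him] at h4; exact (min_le_right _ _).trans ((min_le_left _ _).trans (by linarith))
  · exact absurd ⟨hre, him⟩ hqL
  · rw [hre] at h2; exact (min_le_right _ _).trans ((min_le_right _ _).trans (by linarith))

/-- Distance from a mesh point to the right side. [folklore] -/
theorem infDist_right_eq {p : ℂ} (hx : p.re ≤ A) (hy : p.im ∈ Icc (0 : ℝ) 1) :
    infDist p {z : ℂ | z.re = A ∧ z.im ∈ Icc (0 : ℝ) 1} = A - p.re := by
  refine le_antisymm ?_ ?_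
  · have hmem : (A : ℂ) + (p.im : ℂ) * I ∈ {z : ℂ | z.re = A ∧ z.im ∈ Icc (0 : ℝ) 1} :=
      ⟨by simp, by simpa using hy⟩
    exact (infDist_le_dist_of_mem hmem).trans_eq (dist_foot_right p hx)
  · have hAmem : (A : ℂ) ∈ {z : ℂ | z.re = A ∧ z.im ∈ Icc (0 : ℝ) 1} := ⟨by simp, by simp⟩
    refine (le_infDist ⟨(A : ℂ), hAmem⟩).2 fun q hq ↦ ?_
    have := (re_im_sub_le_dist p q).2.1
    rw [hq.1] at this; linarith

/-- Distance from a mesh point to the frontier minus the right side. [folklore] -/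
theorem le_dist_of_mem_frontier_diff_right (hA : (0 : ℝ) < A) {p q : ℂ}
    (hq : q ∈ frontier (Ioo (0 : ℝ) A ×ℂ Ioo (0 : ℝ) 1) \ {z : ℂ | z.re = A ∧ z.im ∈ Icc (0 : ℝ) 1}) :
    min p.im (min (1 - p.im) p.re) ≤ dist p q := by
  obtain ⟨hqf, hqR⟩ := hq
  obtain ⟨h1, h2, h3, h4⟩ := re_im_sub_le_dist p q
  rcases (mem_frontier_obox hA one_pos).1 hqf with ⟨-, him | him⟩ | ⟨hre | hre, him⟩
  · rw [him] at h3; exact (min_le_left _ _).trans (by linarith)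
  · rw [him] at h4; exact (min_le_right _ _).trans ((min_le_left _ _).trans (by linarith))
  · rw [hre] at h1; exact (min_le_right _ _).trans ((min_le_right _ _).trans (by linarith))
  · exact absurd ⟨hre, him⟩ hqR

/-- Frontier points off the two sides exist (the opposite bottom corner). -/
theorem frontier_diff_nonempty (hA : (0 : ℝ) < A) :
    (frontier (Ioo (0 : ℝ) A ×ℂ Ioo (0 : ℝ) 1) \ {z : ℂ | z.re = 0 ∧ z.im ∈ Icc (0 : ℝ) 1}).Nonempty ∧
    (frontier (Ioo (0 : ℝ) A ×ℂ Ioo (0 : ℝ) 1) \ {z : ℂ | z.re = A ∧ z.im ∈ Icc (0 : ℝ) 1}).Nonempty := by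
  refine ⟨⟨(A : ℂ), (mem_frontier_obox hA one_pos).2 (Or.inr ⟨Or.inr (by simp), by simp⟩), ?_⟩,
    ⟨(0 : ℂ), (mem_frontier_obox hA one_pos).2 (Or.inr ⟨Or.inl (by simp), by simp⟩), ?_⟩⟩
  · intro hmem
    have h1 : ((A : ℂ)).re = 0 := hmem.1
    simp only [natCast_re, Nat.cast_eq_zero] at h1
    subst h1; simp at hA
  · intro hmem
    have h1 : (0 : ℂ).re = (A : ℝ) := hmem.1
    simp only [zero_re] at h1
    exact hA.ne' (by exact_mod_cast h1.symm)

/-- **The discrete arc of the left side is the first column** of the lattice box (`k ≥ 2`, `A ≥ 1`).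
[folklore] -/
theorem discreteArc_left (hA : 1 ≤ A) (hk : 2 ≤ k) (v : Site 2) :
    v ∈ discreteArc (Ioo (0 : ℝ) A ×ℂ Ioo (0 : ℝ) 1) (1 / (k : ℝ)) {z : ℂ | z.re = 0 ∧ z.im ∈ Icc (0 : ℝ) 1} ↔
      v ∈ meshVertices (Ioo (0 : ℝ) A ×ℂ Ioo (0 : ℝ) 1) (1 / (k : ℝ)) ∧ v 0 = 1 := by
  have hk1 : 1 ≤ k := le_trans (by norm_num) hk
  have hδ := mesh_pos (k := k) hk1
  have hAr : (0 : ℝ) < A := by exact_mod_cast hA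
  have hkr : (0 : ℝ) < k := by exact_mod_cast hk1
  have hAk : (2 : ℤ) ≤ (A : ℤ) * k := by
    have : (1 : ℤ) * 2 ≤ (A : ℤ) * k := Int.mul_le_mul (by exact_mod_cast hA) (by exact_mod_cast hk)
      (by norm_num) (by positivity)
    linarith
  set p := meshPoint (1 / (k : ℝ)) v with hp
  obtain ⟨hpre, hpim⟩ := meshPoint_coords (k := k) v
  constructor
  · rintro ⟨hvb, hdist⟩
    obtain ⟨hvV, wv, hadj, hwV⟩ := exists_adj_not_mem_of_mem_meshBoundary_obox hδ hvb
    have hvV' := (mem_meshVertices_brBox hk1).1 hvV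
    refine ⟨hvV, ?_⟩
    -- real-coordinate consequences of the distance comparison
    have hv0r : (1 : ℝ) ≤ v 0 := by exact_mod_cast hvV'.1.1
    have hv0r' : (v 0 : ℝ) + 1 ≤ A * k := by exact_mod_cast hvV'.1.2
    have hv1r : (1 : ℝ) ≤ v 1 := by exact_mod_cast hvV'.2.1
    have hv1r' : (v 1 : ℝ) + 1 ≤ k := by exact_mod_cast hvV'.2.2
    have hxI : p.re ∈ Ioo (0 : ℝ) A := by
      rw [hpre]; exact ⟨by positivity, by rw [div_lt_iff₀ hkr]; linarith⟩
    have hx : 0 ≤ p.re := hxI.1.le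
    have hxA : p.re ≤ A := hxI.2.le
    have hy : p.im ∈ Icc (0 : ℝ) 1 := by
      rw [hpim]; exact ⟨by positivity, by rw [div_le_one hkr]; linarith⟩
    rw [infDist_left_eq hAr hx hy] at hdist
    obtain ⟨hbf, hbL, -⟩ := foot_bottom_mem hAr hxI
    obtain ⟨htf, htL, -⟩ := foot_top_mem hAr hxI
    have hc1 : p.re ≤ p.im :=
      (hdist.trans (infDist_le_dist_of_mem ⟨hbf, hbL⟩)).trans_eq (dist_foot_bottom p hy.1)
    have hc2 : p.re ≤ 1 - p.im :=
      (hdist.trans (infDist_le_dist_of_mem ⟨htf, htL⟩)).trans_eq (dist_foot_top p hy.2)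
    have hc3 : p.re ≤ A - p.re :=
      (hdist.trans (infDist_le_dist_of_mem (foot_right_mem hAr hy))).trans_eq (dist_foot_right p hxA)
    rw [hpre, hpim] at hc1 hc2
    rw [hpre] at hc3
    have hc1' : (v 0 : ℝ) ≤ v 1 := by rwa [div_le_div_iff_of_pos_right hkr] at hc1
    have hc2' : (v 0 : ℝ) + v 1 ≤ k := by
      rw [le_sub_iff_add_le, ← add_div, div_le_one hkr] at hc2; exact hc2
    have hc3' : 2 * (v 0 : ℝ) ≤ A * k := by
      rw [le_sub_iff_add_le, ← add_div, div_le_iff₀ hkr] at hc3; linarith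
    -- the missing neighbour
    rw [mem_meshVertices_brBox hk1] at hwV
    obtain ⟨i, hi | hi⟩ := (zdGraph_adj_iff v wv).1 hadj
    · fin_cases i
      · -- `wv = v + e₀` is outside: `v 0 = Ak - 1`, then `Ak ≤ 2`
        simp only [hi, Fin.zero_eta, Pi.add_apply, Pi.single_eq_same, ne_eq, one_ne_zero,
          not_false_eq_true, Pi.single_eq_of_ne, add_zero] at hwV
        have h0 : (A : ℤ) * k ≤ v 0 + 1 := by omega
        have h0r : (A : ℝ) * k ≤ v 0 + 1 := by exact_mod_cast h0
        have : (v 0 : ℝ) ≤ 1 := by linarith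
        have : v 0 ≤ 1 := by exact_mod_cast this
        omega
      · simp only [hi, Fin.mk_one, Pi.add_apply, ne_eq, zero_ne_one, not_false_eq_true,
          Pi.single_eq_of_ne, add_zero, Pi.single_eq_same] at hwV
        have h0 : (k : ℤ) ≤ v 1 + 1 := by omega
        have h0r : (k : ℝ) ≤ v 1 + 1 := by exact_mod_cast h0
        have : (v 0 : ℝ) ≤ 1 := by linarith
        have : v 0 ≤ 1 := by exact_mod_cast this
        omega
    · fin_cases i
      · have e0 : wv 0 = v 0 - 1 := by have := congr_fun hi 0; simp at this; omega
        have e1 : wv 1 = v 1 := by have := congr_fun hi 1; simpa using this.symm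
        rw [e0, e1] at hwV
        omega
      · have e0 : wv 0 = v 0 := by have := congr_fun hi 0; simpa using this.symm
        have e1 : wv 1 = v 1 - 1 := by have := congr_fun hi 1; simp at this; omega
        rw [e0, e1] at hwV
        have h0 : v 1 = 1 := by omega
        have h0r : (v 1 : ℝ) = 1 := by exact_mod_cast h0
        have : (v 0 : ℝ) ≤ 1 := by linarith
        have : v 0 ≤ 1 := by exact_mod_cast this
        omega
  · rintro ⟨hvV, hv0⟩
    have hvV' := (mem_meshVertices_brBox hk1).1 hvV
    have hv0r : (v 0 : ℝ) = 1 := by exact_mod_cast hv0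
    have hv1r : (1 : ℝ) ≤ v 1 := by exact_mod_cast hvV'.2.1
    have hv1r' : (v 1 : ℝ) + 1 ≤ k := by exact_mod_cast hvV'.2.2
    have hkr2 : (2 : ℝ) ≤ k := by exact_mod_cast hk
    have hAr1 : (1 : ℝ) ≤ A := by exact_mod_cast hA
    refine ⟨mem_meshBoundary_obox hδ hvV (w := v - Pi.single 0 1) ?_ ?_, ?_⟩
    · rw [zdGraph_adj_iff]; exact ⟨0, Or.inr (by simp)⟩
    · rw [mem_meshVertices_brBox hk1]
      simp [hv0]
    · have hx : 0 ≤ p.re := by rw [hpre]; positivity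
      have hy : p.im ∈ Icc (0 : ℝ) 1 := by
        rw [hpim]; exact ⟨by positivity, by rw [div_le_one hkr]; linarith⟩
      rw [infDist_left_eq hAr hx hy]
      refine (le_infDist (frontier_diff_nonempty hAr).1).2 fun q hq ↦ le_trans ?_
        (le_dist_of_mem_frontier_diff_left hAr hq)
      rw [hpre, hpim, hv0r]
      refine le_min ?_ (le_min ?_ ?_)
      · exact div_le_div_of_nonneg_right hv1r hkr.le
      · rw [le_sub_iff_add_le, ← add_div, div_le_one hkr]; linarith
      · rw [le_sub_iff_add_le, ← add_div, div_le_iff₀ hkr]; nlinarith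

end RectBox

/-- Registered sub-goal of this support file: the discrete arc of the left side of `(0,A)×(0,1)` at mesh
`1/k` is the first column of the lattice box. [folklore] -/
theorem rc_discreteArc_left :
    ∀ A k : ℕ, 1 ≤ A → 2 ≤ k → ∀ v : Literature.Probability.LatticeModels.Site 2,
      v ∈ Literature.Probability.LatticeModels.discreteArc (Set.Ioo (0 : ℝ) A ×ℂ Set.Ioo (0 : ℝ) 1) (1 / (k : ℝ))
          {z : ℂ | z.re = 0 ∧ z.im ∈ Set.Icc (0 : ℝ) 1} ↔
        v ∈ Literature.Probability.LatticeModels.meshVertices (Set.Ioo (0 : ℝ) A ×ℂ Set.Ioo (0 : ℝ) 1) (1 / (k : ℝ)) ∧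
          v 0 = 1 :=
  fun _ _ hA hk v => RectBox.discreteArc_left hA hk v

end Summit.CriticalPhenomena.CardyFormulaZ2.Cruxes.StripClusterRates.TwoClusterRateIsStationaryGap

end
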